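import Mathlib
import Summits.NavierStokesRegularity.NavierStokesRegularity.Theorems.EulerZoomLiouvillePowerGaugeEulerLiouvilleDSSNodeSpectralSplitting
import HarnessLib.Audit

/-!
# Crux E `PowerGaugeEulerLiouville` (stmt-NavierStokesRegularity-19832): RATES OF `M^k` IN THE FOUR SPECTRAL CASES and the dominated
# splitting of a power for an operator on `ℝ³` with an expanding eigenvector and a small determinant
# (width seat ns-cas-k2 g3, lane «DSS thin vortical nodes», tool A′ part 2)

Route `EulerZoomLiouville` (NavierStokesRegularity), crux E.  Sequel to `…DSSNodeSpectralSplitting` (cofactor `X² + uX + w` of `χ_M = (X − λ₀)(…)`,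
`w·λ₀ = det M`, Bezout decomposition).  Here: the growth of `M^k` on the pieces, all INTRINSIC (no Jordan form, no complexification):
* `norm_sq_smul_add_smul` — `‖s·a + t·y‖² = s²‖a‖² + 2st⟪a,y⟫ + t²‖y‖²`;
* `adaptedForm_step` / `norm_pow_le_of_complexPair` — COMPLEX PAIR (`u² < 4w`): the adapted quadratic form `N(x) = ‖x‖² + δ⁻²‖Mx + (u/2)x‖²`
  (`δ² = w − u²/4`) satisfies `N(Mx) = w·N(x)` on `ker(M² + uM + w)`, whence `‖M^k x‖ ≤ √(1 + (‖M‖ + |u|/2)²/δ²)·(√w)^k‖x‖`;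
* `pow_succ_apply_of_doubleRoot` / `norm_pow_le_of_doubleRoot` / `le_norm_pow_of_doubleRoot` — on `ker (M − r)²`:
  `M^{k+1}x = r^{k+1}x + (k+1)r^k(Mx − rx)`, so `‖M^{k+1}x‖ ≤ (|r|^{k+1} + (k+1)|r|^k(‖M‖ + |r|))‖x‖` and, for `r > 0`,
  `r^{k+1}‖x‖ ≤ (1 + (k+1)(‖M‖/r + 1))‖M^{k+1}x‖`;
* `le_norm_pow_of_distinctRoots` — on `ker (M − r_b)(M − λ₀)` (`r_b ≠ λ₀`, Lagrange idempotents): `min(|r_b|,|λ₀|)^k‖x‖ ≤ 2C‖M^k x‖`;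
* **`exists_dominatedSplitting_pow`** — `Mω = λ₀ω` (`ω ≠ 0`), `1 < λ₀`, `0 < det M < λ₀` ⇒ `M`-invariant complementary `Es`, `Ec` with `Ec ≠ ⊤` and
  `k ≥ 1`, `a < 1`, `a < b`, `‖M^k x‖ ≤ a‖x‖` on `Es`, `b‖x‖ ≤ ‖M^k x‖` on `Ec` — the hypothesis of `DSSNodes.addHaar_pastHistorySet_eq_zero_of_dominated_pow`.

WHAT THIS IS NOT: not NS regularity, not the crux E — finite-dimensional linear algebra for hypothetical DSS blow-up members; 19832 is OPEN.
[folklore; Robinson1999 Ch. V §5.10.1 (dominated splittings)]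
-/

noncomputable section

set_option linter.dupNamespace false

open Set Filter Topology Function
open scoped RealInnerProductSpace

namespace Summit.NavierStokesRegularity.NavierStokesRegularity.Theorems.PowerGaugeEulerLiouville.DSSNodes

/-! ### Euclidean bookkeeping -/

/-- `‖s·a + t·y‖² = s²‖a‖² + 2st⟪a,y⟫ + t²‖y‖²`. [folklore] -/
theorem norm_sq_smul_add_smul (s t : ℝ) (a y : EuclideanSpace ℝ (Fin 3)) :
    ‖s • a + t • y‖ ^ 2 = s ^ 2 * ‖a‖ ^ 2 + 2 * s * t * ⟪a, y⟫ + t ^ 2 * ‖y‖ ^ 2 := by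
  rw [norm_add_sq_real, norm_smul, norm_smul, real_inner_smul_left, real_inner_smul_right, mul_pow, mul_pow,
    Real.norm_eq_abs, Real.norm_eq_abs, sq_abs, sq_abs]
  ring

/-! ### Complex pair: the adapted quadratic form -/

/-- **One step of the adapted form.**  If `M(My) + uMy + wy = 0` and `δ² := w − u²/4 > 0`, then with `a = My`:
`‖a‖² + δ⁻²‖Ma + (u/2)a‖² = w·(‖y‖² + δ⁻²‖a + (u/2)y‖²)` — in the real block basis `M` is `√w` times a rotation. [folklore] -/
theorem adaptedForm_step (M : EuclideanSpace ℝ (Fin 3) →L[ℝ] EuclideanSpace ℝ (Fin 3)) {u w : ℝ} (hΔ : u ^ 2 < 4 * w)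
    {y : EuclideanSpace ℝ (Fin 3)} (hy : M (M y) + u • M y + w • y = 0) :
    ‖M y‖ ^ 2 + (w - u ^ 2 / 4)⁻¹ * ‖M (M y) + (u / 2) • M y‖ ^ 2 =
      w * (‖y‖ ^ 2 + (w - u ^ 2 / 4)⁻¹ * ‖M y + (u / 2) • y‖ ^ 2) := by
  have hδ : 0 < w - u ^ 2 / 4 := by linarith
  have hMM : M (M y) = (-u) • M y + (-w) • y := by
    rw [← sub_eq_zero, ← hy]; module
  have e1 : M (M y) + (u / 2) • M y = (-(u / 2)) • M y + (-w) • y := by rw [hMM]; module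
  have e2 : M y + (u / 2) • y = (1 : ℝ) • M y + (u / 2) • y := by rw [one_smul]
  rw [e1, e2, norm_sq_smul_add_smul, norm_sq_smul_add_smul]
  have hne : w - u ^ 2 / 4 ≠ 0 := hδ.ne'
  set D : ℝ := w - u ^ 2 / 4 with hD
  set A : ℝ := ‖M y‖ ^ 2
  set Y : ℝ := ‖y‖ ^ 2
  set I : ℝ := ⟪M y, y⟫
  have key : D * A + ((-(u / 2)) ^ 2 * A + 2 * (-(u / 2)) * (-w) * I + (-w) ^ 2 * Y) =
      w * (D * Y + ((1 : ℝ) ^ 2 * A + 2 * 1 * (u / 2) * I + (u / 2) ^ 2 * Y)) := by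
    rw [hD]; ring
  have e3 : A + D⁻¹ * ((-(u / 2)) ^ 2 * A + 2 * (-(u / 2)) * (-w) * I + (-w) ^ 2 * Y) =
      D⁻¹ * (D * A + ((-(u / 2)) ^ 2 * A + 2 * (-(u / 2)) * (-w) * I + (-w) ^ 2 * Y)) := by
    field_simp
  have e4 : w * (Y + D⁻¹ * ((1 : ℝ) ^ 2 * A + 2 * 1 * (u / 2) * I + (u / 2) ^ 2 * Y)) =
      D⁻¹ * (w * (D * Y + ((1 : ℝ) ^ 2 * A + 2 * 1 * (u / 2) * I + (u / 2) ^ 2 * Y))) := by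
    field_simp
  rw [e3, e4, key]

/-- **COMPLEX PAIR RATE.**  `u² < 4w`, `x ∈ ker(M² + uM + w)` ⇒ `‖M^k x‖ ≤ √(1 + (‖M‖ + |u|/2)²/(w − u²/4)) · (√w)^k · ‖x‖`. [folklore] -/
theorem norm_pow_le_of_complexPair (M : EuclideanSpace ℝ (Fin 3) →L[ℝ] EuclideanSpace ℝ (Fin 3)) {u w : ℝ} (hΔ : u ^ 2 < 4 * w)
    {x : EuclideanSpace ℝ (Fin 3)} (hx : M (M x) + u • M x + w • x = 0) (k : ℕ) :
    ‖(M ^ k) x‖ ≤ Real.sqrt (1 + (‖M‖ + |u| / 2) ^ 2 / (w - u ^ 2 / 4)) * Real.sqrt w ^ k * ‖x‖ := by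
  have hδ : 0 < w - u ^ 2 / 4 := by linarith
  have hw0 : 0 < w := by nlinarith [sq_nonneg u]
  -- the form along the orbit: `N(M^k x) = w^k N(x)` (with invariance of the kernel)
  have hstep : ∀ j : ℕ, M (M ((M ^ j) x)) + u • M ((M ^ j) x) + w • (M ^ j) x = 0 ∧
      ‖(M ^ j) x‖ ^ 2 + (w - u ^ 2 / 4)⁻¹ * ‖M ((M ^ j) x) + (u / 2) • (M ^ j) x‖ ^ 2 =
        w ^ j * (‖x‖ ^ 2 + (w - u ^ 2 / 4)⁻¹ * ‖M x + (u / 2) • x‖ ^ 2) := by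
    intro j
    induction j with
    | zero => exact ⟨by simpa using hx, by simp⟩
    | succ j ih =>
        obtain ⟨hker, hN⟩ := ih
        refine ⟨?_, ?_⟩
        · rw [pow_succ_apply']
          have h := congrArg M hker
          rw [map_zero] at h
          rw [← h]
          simp only [map_add, map_smul]
        · rw [pow_succ_apply', adaptedForm_step M hΔ hker, hN, pow_succ]
          ring
  obtain ⟨_, hN⟩ := hstep k
  set C2 : ℝ := 1 + (‖M‖ + |u| / 2) ^ 2 / (w - u ^ 2 / 4) with hC2
  have hJ : ‖M x + (u / 2) • x‖ ≤ (‖M‖ + |u| / 2) * ‖x‖ := by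
    calc ‖M x + (u / 2) • x‖ ≤ ‖M x‖ + ‖(u / 2) • x‖ := norm_add_le _ _
      _ ≤ ‖M‖ * ‖x‖ + |u| / 2 * ‖x‖ := by
          rw [norm_smul, Real.norm_eq_abs, abs_div, abs_two]
          exact add_le_add (M.le_opNorm x) le_rfl
      _ = (‖M‖ + |u| / 2) * ‖x‖ := by ring
  have hNx : ‖x‖ ^ 2 + (w - u ^ 2 / 4)⁻¹ * ‖M x + (u / 2) • x‖ ^ 2 ≤ C2 * ‖x‖ ^ 2 := by
    have h1 : ‖M x + (u / 2) • x‖ ^ 2 ≤ ((‖M‖ + |u| / 2) * ‖x‖) ^ 2 :=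
      pow_le_pow_left₀ (norm_nonneg _) hJ 2
    have h2 : (w - u ^ 2 / 4)⁻¹ * ‖M x + (u / 2) • x‖ ^ 2 ≤ (w - u ^ 2 / 4)⁻¹ * ((‖M‖ + |u| / 2) * ‖x‖) ^ 2 :=
      mul_le_mul_of_nonneg_left h1 (inv_nonneg.2 hδ.le)
    rw [hC2]
    have e : (1 + (‖M‖ + |u| / 2) ^ 2 / (w - u ^ 2 / 4)) * ‖x‖ ^ 2 =
        ‖x‖ ^ 2 + (w - u ^ 2 / 4)⁻¹ * ((‖M‖ + |u| / 2) * ‖x‖) ^ 2 := by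
      field_simp
    rw [e]
    linarith
  have hsq : ‖(M ^ k) x‖ ^ 2 ≤ (Real.sqrt C2 * Real.sqrt w ^ k * ‖x‖) ^ 2 := by
    have hC20 : 0 ≤ C2 := by rw [hC2]; positivity
    rw [mul_pow, mul_pow, Real.sq_sqrt hC20, ← pow_mul, mul_comm k 2, pow_mul, Real.sq_sqrt hw0.le]
    have h3 : 0 ≤ (w - u ^ 2 / 4)⁻¹ * ‖M ((M ^ k) x) + (u / 2) • (M ^ k) x‖ ^ 2 := by positivity
    calc ‖(M ^ k) x‖ ^ 2 ≤ w ^ k * (‖x‖ ^ 2 + (w - u ^ 2 / 4)⁻¹ * ‖M x + (u / 2) • x‖ ^ 2) := by linarith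
      _ ≤ w ^ k * (C2 * ‖x‖ ^ 2) := mul_le_mul_of_nonneg_left hNx (pow_nonneg hw0.le k)
      _ = C2 * w ^ k * ‖x‖ ^ 2 := by ring
  have hnn : 0 ≤ Real.sqrt C2 * Real.sqrt w ^ k * ‖x‖ := by positivity
  exact (pow_le_pow_iff_left₀ (norm_nonneg _) hnn two_ne_zero).1 hsq

/-! ### Double root: nilpotent bookkeeping on `ker (M − r)²` -/

/-- On `ker (M − r)²` (`M(Mx) − 2rMx + r²x = 0`): `M^{k+1}x = r^{k+1}x + (k+1)r^k(Mx − rx)`. [folklore] -/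
theorem pow_succ_apply_of_doubleRoot (M : EuclideanSpace ℝ (Fin 3) →L[ℝ] EuclideanSpace ℝ (Fin 3)) {r : ℝ}
    {x : EuclideanSpace ℝ (Fin 3)} (hx : M (M x) + (-(2 * r)) • M x + r ^ 2 • x = 0) (k : ℕ) :
    (M ^ (k + 1)) x = r ^ (k + 1) • x + (((k : ℝ) + 1) * r ^ k) • (M x - r • x) := by
  have hMM : M (M x) = (2 * r) • M x + (-(r ^ 2)) • x := by
    rw [← sub_eq_zero, ← hx]; module
  induction k with
  | zero => simp
  | succ k ih =>
      rw [pow_succ_apply', ih]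
      simp only [map_add, map_smul, map_sub, hMM]
      push_cast
      rw [pow_succ, pow_succ]
      module

/-- **DOUBLE ROOT, UPPER RATE.**  On `ker (M − r)²`: `‖M^{k+1}x‖ ≤ (|r|^{k+1} + (k+1)|r|^k(‖M‖ + |r|))‖x‖`. [folklore] -/
theorem norm_pow_le_of_doubleRoot (M : EuclideanSpace ℝ (Fin 3) →L[ℝ] EuclideanSpace ℝ (Fin 3)) {r : ℝ}
    {x : EuclideanSpace ℝ (Fin 3)} (hx : M (M x) + (-(2 * r)) • M x + r ^ 2 • x = 0) (k : ℕ) :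
    ‖(M ^ (k + 1)) x‖ ≤ (|r| ^ (k + 1) + ((k : ℝ) + 1) * |r| ^ k * (‖M‖ + |r|)) * ‖x‖ := by
  rw [pow_succ_apply_of_doubleRoot M hx k]
  have h1 : ‖M x - r • x‖ ≤ (‖M‖ + |r|) * ‖x‖ := by
    calc ‖M x - r • x‖ ≤ ‖M x‖ + ‖r • x‖ := norm_sub_le _ _
      _ ≤ ‖M‖ * ‖x‖ + |r| * ‖x‖ := by rw [norm_smul, Real.norm_eq_abs]; exact add_le_add (M.le_opNorm x) le_rfl
      _ = (‖M‖ + |r|) * ‖x‖ := by ring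
  have hk : 0 ≤ ((k : ℝ) + 1) * |r| ^ k := by positivity
  calc ‖r ^ (k + 1) • x + (((k : ℝ) + 1) * r ^ k) • (M x - r • x)‖
      ≤ ‖r ^ (k + 1) • x‖ + ‖(((k : ℝ) + 1) * r ^ k) • (M x - r • x)‖ := norm_add_le _ _
    _ = |r| ^ (k + 1) * ‖x‖ + ((k : ℝ) + 1) * |r| ^ k * ‖M x - r • x‖ := by
        rw [norm_smul, norm_smul, Real.norm_eq_abs, Real.norm_eq_abs, abs_pow, abs_mul, abs_pow,
          abs_of_nonneg (by positivity : (0 : ℝ) ≤ (k : ℝ) + 1)]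
    _ ≤ |r| ^ (k + 1) * ‖x‖ + ((k : ℝ) + 1) * |r| ^ k * ((‖M‖ + |r|) * ‖x‖) := by
        have := mul_le_mul_of_nonneg_left h1 hk
        linarith
    _ = (|r| ^ (k + 1) + ((k : ℝ) + 1) * |r| ^ k * (‖M‖ + |r|)) * ‖x‖ := by ring

/-- **DOUBLE ROOT, LOWER RATE** (`r > 0`).  On `ker (M − r)²`: `r^{k+1}‖x‖ ≤ (1 + (k+1)(‖M‖/r + 1))·‖M^{k+1}x‖` — with `z = M^{k+1}x`,
`r^{k+1}x = z − ((k+1)/r)(Mz − rz)`. [folklore] -/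
theorem le_norm_pow_of_doubleRoot (M : EuclideanSpace ℝ (Fin 3) →L[ℝ] EuclideanSpace ℝ (Fin 3)) {r : ℝ} (hr : 0 < r)
    {x : EuclideanSpace ℝ (Fin 3)} (hx : M (M x) + (-(2 * r)) • M x + r ^ 2 • x = 0) (k : ℕ) :
    r ^ (k + 1) * ‖x‖ ≤ (1 + ((k : ℝ) + 1) * (‖M‖ / r + 1)) * ‖(M ^ (k + 1)) x‖ := by
  have hMM : M (M x) = (2 * r) • M x + (-(r ^ 2)) • x := by
    rw [← sub_eq_zero, ← hx]; module
  set z := (M ^ (k + 1)) x with hz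
  have hzx : z = r ^ (k + 1) • x + (((k : ℝ) + 1) * r ^ k) • (M x - r • x) := pow_succ_apply_of_doubleRoot M hx k
  -- `Mz − rz = r^{k+1}(Mx − rx)`
  have hNz : M z - r • z = r ^ (k + 1) • (M x - r • x) := by
    rw [hzx]
    simp only [map_add, map_smul, map_sub, hMM]
    rw [pow_succ]
    module
  have hkey : r ^ (k + 1) • x = z - (((k : ℝ) + 1) / r) • (M z - r • z) := by
    rw [hNz, hzx, smul_smul, pow_succ]
    have e : ((k : ℝ) + 1) / r * (r ^ k * r) = ((k : ℝ) + 1) * r ^ k := by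
      field_simp
    rw [e]
    module
  have h1 : ‖M z - r • z‖ ≤ (‖M‖ + r) * ‖z‖ := by
    calc ‖M z - r • z‖ ≤ ‖M z‖ + ‖r • z‖ := norm_sub_le _ _
      _ ≤ ‖M‖ * ‖z‖ + r * ‖z‖ := by
          rw [norm_smul, Real.norm_eq_abs, abs_of_pos hr]; exact add_le_add (M.le_opNorm z) le_rfl
      _ = (‖M‖ + r) * ‖z‖ := by ring
  have hcoef : 0 ≤ ((k : ℝ) + 1) / r := by positivity
  calc r ^ (k + 1) * ‖x‖ = ‖r ^ (k + 1) • x‖ := by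
        rw [norm_smul, Real.norm_eq_abs, abs_of_pos (pow_pos hr _)]
    _ = ‖z - (((k : ℝ) + 1) / r) • (M z - r • z)‖ := by rw [hkey]
    _ ≤ ‖z‖ + ‖(((k : ℝ) + 1) / r) • (M z - r • z)‖ := norm_sub_le _ _
    _ = ‖z‖ + ((k : ℝ) + 1) / r * ‖M z - r • z‖ := by rw [norm_smul, Real.norm_eq_abs, abs_of_nonneg hcoef]
    _ ≤ ‖z‖ + ((k : ℝ) + 1) / r * ((‖M‖ + r) * ‖z‖) := by
        have := mul_le_mul_of_nonneg_left h1 hcoef; linarith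
    _ = (1 + ((k : ℝ) + 1) * (‖M‖ / r + 1)) * ‖z‖ := by
        field_simp

/-! ### Distinct real roots: Lagrange idempotents on `ker (M − r_b)(M − λ₀)` -/

/-- **DISTINCT ROOTS, LOWER RATE.**  `r_b ≠ λ₀`, `x ∈ ker (M − r_b)(M − λ₀)` (`M(Mx) − (r_b+λ₀)Mx + r_bλ₀x = 0`) ⇒ for every `k`,
`min(|r_b|,|λ₀|)^k ‖x‖ ≤ 2·|λ₀ − r_b|⁻¹(‖M‖ + |λ₀| + |r_b|)·‖M^k x‖`: `x = y_b + y_ω` with `My_b = r_by_b`, `My_ω = λ₀y_ω`, and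
`r_b^k y_b = (λ₀ − r_b)⁻¹(λ₀z − Mz)`, `λ₀^k y_ω = (λ₀ − r_b)⁻¹(Mz − r_bz)` for `z = M^k x`. [folklore] -/
theorem le_norm_pow_of_distinctRoots (M : EuclideanSpace ℝ (Fin 3) →L[ℝ] EuclideanSpace ℝ (Fin 3)) {rb lam₀ : ℝ}
    (hne : rb ≠ lam₀) {x : EuclideanSpace ℝ (Fin 3)}
    (hx : M (M x) + (-(rb + lam₀)) • M x + (rb * lam₀) • x = 0) (k : ℕ) :
    (min |rb| |lam₀|) ^ k * ‖x‖ ≤ 2 * (|lam₀ - rb|⁻¹ * (‖M‖ + |lam₀| + |rb|)) * ‖(M ^ k) x‖ := by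
  have hd : lam₀ - rb ≠ 0 := sub_ne_zero.2 (Ne.symm hne)
  have hMM : M (M x) = (rb + lam₀) • M x + (-(rb * lam₀)) • x := by
    rw [← sub_eq_zero, ← hx]; module
  set yb : EuclideanSpace ℝ (Fin 3) := (lam₀ - rb)⁻¹ • (lam₀ • x - M x) with hyb
  set yo : EuclideanSpace ℝ (Fin 3) := (lam₀ - rb)⁻¹ • (M x - rb • x) with hyo
  have hsum : yb + yo = x := by
    rw [hyb, hyo, ← smul_add]
    have e : lam₀ • x - M x + (M x - rb • x) = (lam₀ - rb) • x := by module
    rw [e, smul_smul, inv_mul_cancel₀ hd, one_smul]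
  have hMyb : M yb = rb • yb := by
    rw [hyb]; simp only [map_smul, map_sub, hMM]; module
  have hMyo : M yo = lam₀ • yo := by
    rw [hyo]; simp only [map_smul, map_sub, hMM]; module
  clear_value yb yo
  set z := (M ^ k) x with hz
  have hzeq : z = rb ^ k • yb + lam₀ ^ k • yo := by
    rw [hz, ← hsum, map_add, pow_apply_of_eigen M hMyb, pow_apply_of_eigen M hMyo]
  have hMz : M z = rb ^ (k + 1) • yb + lam₀ ^ (k + 1) • yo := by
    rw [hzeq, map_add, map_smul, map_smul, hMyb, hMyo, smul_smul, smul_smul, ← pow_succ, ← pow_succ]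
  have hb : rb ^ k • yb = (lam₀ - rb)⁻¹ • (lam₀ • z - M z) := by
    rw [hMz, hzeq, pow_succ, pow_succ]
    have e : lam₀ • (rb ^ k • yb + lam₀ ^ k • yo) - ((rb ^ k * rb) • yb + (lam₀ ^ k * lam₀) • yo) =
        (lam₀ - rb) • (rb ^ k • yb) := by module
    rw [e, smul_smul, inv_mul_cancel₀ hd, one_smul]
  have ho : lam₀ ^ k • yo = (lam₀ - rb)⁻¹ • (M z - rb • z) := by
    rw [hMz, hzeq, pow_succ, pow_succ]
    have e : (rb ^ k * rb) • yb + (lam₀ ^ k * lam₀) • yo - rb • (rb ^ k • yb + lam₀ ^ k • yo) =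
        (lam₀ - rb) • (lam₀ ^ k • yo) := by module
    rw [e, smul_smul, inv_mul_cancel₀ hd, one_smul]
  set C : ℝ := |lam₀ - rb|⁻¹ * (‖M‖ + |lam₀| + |rb|) with hC
  have hC0 : 0 ≤ C := by positivity
  have hnb : ‖rb ^ k • yb‖ ≤ C * ‖z‖ := by
    rw [hb, norm_smul, Real.norm_eq_abs, abs_inv, hC, mul_assoc]
    refine mul_le_mul_of_nonneg_left ?_ (by positivity)
    calc ‖lam₀ • z - M z‖ ≤ ‖lam₀ • z‖ + ‖M z‖ := norm_sub_le _ _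
      _ ≤ |lam₀| * ‖z‖ + ‖M‖ * ‖z‖ := by rw [norm_smul, Real.norm_eq_abs]; exact add_le_add le_rfl (M.le_opNorm z)
      _ ≤ (‖M‖ + |lam₀| + |rb|) * ‖z‖ := by nlinarith [abs_nonneg rb, norm_nonneg z]
  have hno : ‖lam₀ ^ k • yo‖ ≤ C * ‖z‖ := by
    rw [ho, norm_smul, Real.norm_eq_abs, abs_inv, hC, mul_assoc]
    refine mul_le_mul_of_nonneg_left ?_ (by positivity)
    calc ‖M z - rb • z‖ ≤ ‖M z‖ + ‖rb • z‖ := norm_sub_le _ _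
      _ ≤ ‖M‖ * ‖z‖ + |rb| * ‖z‖ := by rw [norm_smul, Real.norm_eq_abs]; exact add_le_add (M.le_opNorm z) le_rfl
      _ ≤ (‖M‖ + |lam₀| + |rb|) * ‖z‖ := by nlinarith [abs_nonneg lam₀, norm_nonneg z]
  set m : ℝ := min |rb| |lam₀| with hm
  have hm0 : 0 ≤ m := le_min (abs_nonneg _) (abs_nonneg _)
  have h1 : m ^ k * ‖yb‖ ≤ ‖rb ^ k • yb‖ := by
    rw [norm_smul, Real.norm_eq_abs, abs_pow]
    exact mul_le_mul_of_nonneg_right (pow_le_pow_left₀ hm0 (min_le_left _ _) k) (norm_nonneg _)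
  have h2 : m ^ k * ‖yo‖ ≤ ‖lam₀ ^ k • yo‖ := by
    rw [norm_smul, Real.norm_eq_abs, abs_pow]
    exact mul_le_mul_of_nonneg_right (pow_le_pow_left₀ hm0 (min_le_right _ _) k) (norm_nonneg _)
  have h3 : ‖x‖ ≤ ‖yb‖ + ‖yo‖ := by rw [← hsum]; exact norm_add_le _ _
  have h4 : m ^ k * ‖x‖ ≤ m ^ k * (‖yb‖ + ‖yo‖) := mul_le_mul_of_nonneg_left h3 (pow_nonneg hm0 k)
  linarith

end Summit.NavierStokesRegularity.NavierStokesRegularity.Theorems.PowerGaugeEulerLiouville.DSSNodes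

end
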